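import Mathlib
import Summits.ResolutionOfSingularities.ResolutionOfSingularities.Theses.SyzygyFlattening
import Summits.ResolutionOfSingularities.ResolutionOfSingularities.Theorems.SyzygyFlatteningDefs
import Summits.ResolutionOfSingularities.ResolutionOfSingularities.Theorems.SyzygyFlatteningHigherRankTerminationReduction
import Summits.ResolutionOfSingularities.ResolutionOfSingularities.Theorems.SyzygyFlatteningHigherRankTerminationRepair
import Summits.ResolutionOfSingularities.ResolutionOfSingularities.Theorems.SyzygyFlatteningHigherRankTerminationPosDimRankOne
import HarnessLib

/-!
# `HigherRankTermination` IS residual steering; the filed crux is equivalent to the repaired one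

Crux `HigherRankTermination` (stmt-ResolutionOfSingularities-17045) of route
`ResolutionOfSingularities/SyzygyFlattening`, line `birth`, lead c2.

With `stub_posDimRankOne` landed UNCONDITIONALLY relative to the crux's own hypothesis
(`allRankOne_of_rankOneInput`: `RankOneInput p` — rank one AND dimension zero, index `n` — already
gives termination along every rank-one valuation of any dimension at the same index, by the
index-preserving base change `(k, K) ↦ (k(X), K(X))`), the kernel-checked reduction of lead -0
(`stub_cruxReduction`, p155678) and the repair glue of lead c1 (`stub_repairWeaker`,
`stub_repairReduction`, p163204) combine into:

* `higherRankTermination_iff_residualSteering` — the crux is EQUIVALENT to: for every prime `p`,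
  `RankOneInput p` implies RESIDUAL STEERING (the statement of the one remaining stub
  `stub_residualSteering` of the line `birth`): for a dimension-zero valuation ring `O` of rank ≥ 2
  and a proper coarsening `O < O₁ < K`, eventual persistent regularity of the `O`-tower at the
  centre of `O₁` implies termination along `O`.
* `higherRankTermination_iff_repaired` — the crux AS FILED is equivalent to the REPAIRED crux of
  `MISSTATED-c1.md` (`∀ p prime, AllRankOne p → DimZeroTermination p`): route-review objection O1
  does not make the item mis-stated; it is answered inside the crux.

So the item `HigherRankTermination` is exactly its registered stub `stub_residualSteering`, under
the hypothesis `RankOneInput p`; nothing else is hidden in it.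

References: Novacoski–Spivakovsky 2014, Thm. 1.1 (shape of the rank induction); Kuhlmann 2010,
Lemma 2.5 (the value-transcendental base change).
-/

noncomputable section

-- single-problem summit: the doubled namespace component `ResolutionOfSingularities` is forced
set_option linter.dupNamespace false

open Summit.ResolutionOfSingularities.ResolutionOfSingularities.Theses.SyzygyFlattening
  (HigherRankTermination)

namespace Summit.ResolutionOfSingularities.ResolutionOfSingularities.Theorems.SyzygyFlattening

/-- **The crux is residual steering.** `HigherRankTermination` holds iff, for every prime `p`,
`RankOneInput p` implies residual steering (the statement of `stub_residualSteering`): the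
positive-dimensional rank-one half of `stub_cruxReduction` is discharged by `stub_posDimRankOne`.
[cite: NovacoskiSpivakovsky2014, Thm. 1.1 (shape of the induction)] -/
theorem higherRankTermination_iff_residualSteering :
    HigherRankTermination ↔
      ∀ (p : ℕ), p.Prime → RankOneInput p →
        ∀ (k K : Type) [Field k] [CharP k p] [Field K] [Algebra k K] (O : ValuationSubring K)
          (A : Subalgebra k K), (∀ c : k, algebraMap k K c ∈ O) → A.FG → IsFractionRing ↥A K →
          A.toSubring ≤ O.toSubring → DimZero k O →
          ∀ O₁ : ValuationSubring K, O < O₁ → O₁ ≠ ⊤ → EventuallyRegularAlong O A O₁ →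
          TowerTerminates O A := by
  rw [stub_cruxReduction]
  constructor
  · intro h p hp hR1
    exact (h p hp hR1).2
  · intro h p hp hR1
    exact ⟨stub_posDimRankOne p hp hR1, h p hp hR1⟩

/-- **The filed crux is equivalent to the repaired crux** (`HR' = ∀ p prime, AllRankOne p →
DimZeroTermination p`, MISSTATED-c1.md): (→) `stub_repairWeaker`; (←) `RankOneInput p` already
gives `AllRankOne p` (`allRankOne_of_rankOneInput'`). So objection O1 is answered inside the item;
the crux is not mis-stated. [folklore] -/
theorem higherRankTermination_iff_repaired :
    HigherRankTermination ↔
      ∀ p : ℕ, p.Prime →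
        (∀ (k K : Type) [Field k] [CharP k p] [Field K] [Algebra k K] (O : ValuationSubring K)
          (A : Subalgebra k K), (∀ c : k, algebraMap k K c ∈ O) → A.FG → IsFractionRing ↥A K →
          A.toSubring ≤ O.toSubring → ringKrullDim ↥O = 1 → TowerTerminates O A) →
        ∀ (k K : Type) [Field k] [CharP k p] [Field K] [Algebra k K] (O : ValuationSubring K)
          (A : Subalgebra k K), (∀ c : k, algebraMap k K c ∈ O) → A.FG → IsFractionRing ↥A K →
          A.toSubring ≤ O.toSubring → DimZero k O → TowerTerminates O A := by
  constructor
  · exact stub_repairWeaker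
  · intro h
    refine higherRankTermination_iff.mpr fun p hp hR1 k K _ _ _ _ O A hk hFG hFrac hAO halg => ?_
    exact h p hp (allRankOne_of_rankOneInput' p hR1) k K O A hk hFG hFrac hAO halg

end Summit.ResolutionOfSingularities.ResolutionOfSingularities.Theorems.SyzygyFlattening

end
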